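import Mathlib.GroupTheory.FiniteAbelian.Duality
import Mathlib.Algebra.GroupWithZero.Units.Fintype
import Summits.BirchSwinnertonDyer.BirchSwinnertonDyer.Theorems.GenusKolyvaginAtTwoTorsionCellGenusDepth
import HarnessLib

/-!
# LINE 49 «full_vertex» — the character group of an elementary abelian `2`-group: `|Ĝ| = |G|` and `Ĝ` separates `G`

Crux R″ `RankOneTwoTorsionResidualAtTwo` (stmt-BirchSwinnertonDyer-27478) of route GenusKolyvaginAtTwo, LINE 49
«torsion_cell_full_vertex_bsdidea1» (pen bsd-idea-1); companion of `…TorsionCellGenusDepth` / `…GenusDepthTorsion`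
(memo #6 §2, Theorem A and the (LOW) dictionary).  Those theorems carry the hypotheses
`hdual : Fintype.card (G →* ℤˣ) = 2^k` and `hsep : ∀ g ≠ 1, ∃ χ : G →* ℤˣ, χ g ≠ 1` («the `ℤˣ`-valued characters are ALL
the characters and separate `G`»).  For the genus group `G = Gal(K_gen/K) ≅ (ℤ/2)^k` — any finite group in which every
element squares to `1` — both hypotheses HOLD; this file discharges them once and for all from Mathlib's duality for finite
abelian groups (`CommGroup.exists_apply_ne_one_of_hasEnoughRootsOfUnity`, `CommGroup.card_monoidHom_of_hasEnoughRootsOfUnity`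
with `M = ℤ`, which has enough square roots of unity: `±1`).

* `hasEnoughRootsOfUnity_int_two` — `ℤ` has enough `2`nd roots of unity (`rootsOfUnity 2 ℤ = ℤˣ = {±1}`, cyclic);
* `mul_comm_of_forall_mul_self_eq_one`, `exponent_dvd_two_of_forall_mul_self_eq_one` — a group of exponent `2` is abelian;
* **`exists_monoidHom_unitsInt_apply_ne_one`** — `hsep`: in a finite group with `g² = 1` for all `g`, the characters
  `G →* ℤˣ` separate points;
* **`natCard_monoidHom_unitsInt_eq`**, **`card_monoidHom_unitsInt_eq_two_pow`** — `hdual`: `#(G →* ℤˣ) = #G` (`= 2^k`).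

Everything is proved (no `sorry`, standard axioms; no instance is declared — the abelian structure and the roots-of-unity
witness are built inside the proofs); nothing here is a statement of the line, and NOTHING HERE PROVES R″ or any summit.

## References

* [Serre1977] J.-P. Serre, *Linear Representations of Finite Groups*, §2.3 / §3.1 (characters of finite abelian groups).
-/

namespace Summit.BirchSwinnertonDyer.BirchSwinnertonDyer.Theorems.GenusKolyvaginAtTwo.FullVertex.GenusDepth

/-- Every unit of `ℤ` is a `2`nd root of unity: `rootsOfUnity 2 ℤ = ⊤`. [cite: Serre1977, §3.1] -/
theorem rootsOfUnity_two_int_eq_top : rootsOfUnity 2 ℤ = ⊤ := by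
  ext u
  simp only [mem_rootsOfUnity, Subgroup.mem_top, iff_true]
  rw [pow_two, Int.units_mul_self]

/-- `ℤ` has enough `2`nd roots of unity (`±1`; the group of square roots of unity in a domain is cyclic). [cite: Serre1977, §3.1] -/
theorem hasEnoughRootsOfUnity_int_two : HasEnoughRootsOfUnity ℤ 2 := by
  refine HasEnoughRootsOfUnity.of_card_le ?_
  rw [rootsOfUnity_two_int_eq_top, Nat.card_congr Subgroup.topEquiv.toEquiv, Nat.card_eq_fintype_card,
    Fintype.card_units_int]

section ExponentTwo

variable {G : Type*} [Group G]

/-- A group in which every element squares to `1` is abelian. [cite: Serre1977, §3.1] -/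
theorem mul_comm_of_forall_mul_self_eq_one (h2 : ∀ g : G, g * g = 1) (a b : G) : a * b = b * a := by
  have hinv : ∀ g : G, g⁻¹ = g := fun g => inv_eq_of_mul_eq_one_right (h2 g)
  calc a * b = (a * b)⁻¹ := (hinv (a * b)).symm
    _ = b⁻¹ * a⁻¹ := mul_inv_rev a b
    _ = b * a := by rw [hinv, hinv]

/-- In a group with `g² = 1` for all `g`, the exponent divides `2`. [cite: Serre1977, §3.1] -/
theorem exponent_dvd_two_of_forall_mul_self_eq_one (h2 : ∀ g : G, g * g = 1) : Monoid.exponent G ∣ 2 :=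
  Monoid.exponent_dvd_of_forall_pow_eq_one fun g => by rw [pow_two, h2 g]

variable [Finite G]

/-- **`hsep` for elementary abelian `2`-groups.**  In a finite group in which every element squares to `1`, the
`ℤˣ`-valued characters SEPARATE points: `g ≠ 1 ⟹ ∃ χ : G →* ℤˣ, χ g ≠ 1` (Mathlib's duality for finite abelian groups,
with `M = ℤ`). [cite: Serre1977, §3.1] -/
theorem exists_monoidHom_unitsInt_apply_ne_one (h2 : ∀ g : G, g * g = 1) {g : G} (hg : g ≠ 1) :
    ∃ χ : G →* ℤˣ, χ g ≠ 1 := by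
  letI : CommGroup G := { ‹Group G› with mul_comm := mul_comm_of_forall_mul_self_eq_one h2 }
  haveI : HasEnoughRootsOfUnity ℤ 2 := hasEnoughRootsOfUnity_int_two
  haveI : HasEnoughRootsOfUnity ℤ (Monoid.exponent G) :=
    HasEnoughRootsOfUnity.of_dvd ℤ (exponent_dvd_two_of_forall_mul_self_eq_one h2)
  exact CommGroup.exists_apply_ne_one_of_hasEnoughRootsOfUnity G ℤ hg

/-- **`hdual` for elementary abelian `2`-groups (cardinal form).**  `#(G →* ℤˣ) = #G`. [cite: Serre1977, §3.1] -/
theorem natCard_monoidHom_unitsInt_eq (h2 : ∀ g : G, g * g = 1) : Nat.card (G →* ℤˣ) = Nat.card G := by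
  letI : CommGroup G := { ‹Group G› with mul_comm := mul_comm_of_forall_mul_self_eq_one h2 }
  haveI : HasEnoughRootsOfUnity ℤ 2 := hasEnoughRootsOfUnity_int_two
  haveI : HasEnoughRootsOfUnity ℤ (Monoid.exponent G) :=
    HasEnoughRootsOfUnity.of_dvd ℤ (exponent_dvd_two_of_forall_mul_self_eq_one h2)
  exact CommGroup.card_monoidHom_of_hasEnoughRootsOfUnity G ℤ

/-- **`hdual` in the shape used by the (LOW) dictionary:** `Fintype.card G = 2^k ⟹ Fintype.card (G →* ℤˣ) = 2^k` (for any
`Fintype` structure on the character group). [cite: Serre1977, §3.1] -/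
theorem card_monoidHom_unitsInt_eq_two_pow [Fintype G] [Fintype (G →* ℤˣ)] (h2 : ∀ g : G, g * g = 1) {k : ℕ}
    (hG : Fintype.card G = 2 ^ k) : Fintype.card (G →* ℤˣ) = 2 ^ k := by
  rw [← hG, ← Nat.card_eq_fintype_card, ← Nat.card_eq_fintype_card]
  exact natCard_monoidHom_unitsInt_eq h2

end ExponentTwo

end Summit.BirchSwinnertonDyer.BirchSwinnertonDyer.Theorems.GenusKolyvaginAtTwo.FullVertex.GenusDepth
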